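import Mathlib
import Summits.Ventures.PercRepro2.Defs
import Summits.Ventures.PercRepro2.Independence
import Summits.Ventures.PercRepro2.Graph
import Summits.Ventures.PercRepro2.Induced
import Summits.Ventures.PercRepro2.HullDefs
import Summits.Ventures.PercRepro2.HullFlip
import Summits.Ventures.PercRepro2.HullTheoremA
import Summits.Ventures.PercRepro2.HullCount
import Summits.Ventures.PercRepro2.HullDom
import Summits.Ventures.PercRepro2.HullPieceFlip
import Summits.Ventures.PercRepro2.LocRows
import Summits.Ventures.PercRepro2.Loc0Dom

/-!
# The BL-local injection of row 2′LOC gives row 2′DOM2 (and 2′DOM) on the free fibre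
(blind cell PercRepro2, p1 g7; lead g11 CONJECTURES v2.99f row 2′LOC, ADDENDUM 25 (39)/(44);
engine D63 = NEG-64: the piece-local `(LOC0)` fails from `n = 8`, the BL-local `(LOC-𝓤)` is clean)

`(LOC-𝓤)` (`LocRows.LocU`) is an injection `{h ∉ H_l, C_B(l) ∈ 𝓤, C_R(l) ∉ 𝓤} → {h ∉ H_l, C_R(l) ∈ 𝓤,
C_B(l) ∉ 𝓤}` recolouring only edges touching `C_B(l)` of the source. A blue path from `h ∉ H_l`
never meets `C_B(l)`, so every such recolouring keeps the blue cluster of `h`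
(`conn_of_eqOn_off_touches`), and the injection carries `{C_B(h) ∈ 𝓥}` into itself for every
up-set `𝓥`. Row 2′DOM2 (fibre-BHK 1.4 on the free fibre) is the signed count
`dom2Sum 𝓤 𝓥 = Σ_ζ 1[h ∉ H_l]·(1[C_R(l) ∈ 𝓤] − 1[C_B(l) ∈ 𝓤])·1[C_B(h) ∈ 𝓥]`, which equals
`#(tgtU ∩ {C_B(h) ∈ 𝓥}) − #(srcU ∩ {C_B(h) ∈ 𝓥})` (the configurations with both or neither cluster
in `𝓤` carry coefficient `0`); hence:

* **`dom2Sum_nonneg_of_locU`**: `(LOC-𝓤)` at `𝓤` gives row 2′DOM2 at `(𝓤, 𝓥)` for every up-set `𝓥`;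
* **`domSumG_univ_nonneg_of_locU`**: `(LOC-𝓤)` at the principal up-set `{S ∣ o ∈ S}` gives row 2′DOM
  on the free fibre (`Loc0Dom` needed the piece-local `(LOC0)`, which NEG-64 refutes at `n = 8`;
  the BL-local hypothesis is the one with the clean census).
-/

namespace Summit.Ventures.PercRepro2

namespace Hull

open scoped Classical

variable {V : Type*} {E : Type*} [Fintype E] [DecidableEq E]
  {R : Type*} [Field R] [LinearOrder R] [IsStrictOrderedRing R]

variable (ends : E → Sym2 V)

/-- **Row 2′DOM2 on the free fibre** (signed count):
`Σ_ζ 1[h ∉ H_l] · (1[C_R(l) ∈ 𝓤] − 1[C_B(l) ∈ 𝓤]) · 1[C_B(h) ∈ 𝓥]`. -/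
noncomputable def dom2Sum (R : Type*) [Ring R] (l h : V) (𝓤 𝓥 : Set (Set V)) : R :=
  ∑ ζ : Config E, (if h ∉ hull ends ζ l then 1 else 0) *
    ((if cluster ends ζ l ∈ 𝓤 then 1 else 0) - (if cluster ends (blue ζ) l ∈ 𝓤 then 1 else 0)) *
    (if cluster ends (blue ζ) h ∈ 𝓥 then 1 else 0)

/-- Membership in `tgtU ∩ {C_B(h) ∈ 𝓥}`. -/
lemma mem_tgtUIn {l h : V} {𝓤 𝓥 : Set (Set V)} {ζ : Config E} :
    ζ ∈ ((LocRows.tgtU ends l h 𝓤).filter fun ζ => cluster ends (blue ζ) h ∈ 𝓥) ↔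
      (h ∉ hull ends ζ l ∧ cluster ends ζ l ∈ 𝓤 ∧ cluster ends (blue ζ) l ∉ 𝓤) ∧
        cluster ends (blue ζ) h ∈ 𝓥 := by
  simp [LocRows.tgtU]

/-- Membership in `srcU ∩ {C_B(h) ∈ 𝓥}`. -/
lemma mem_srcUIn {l h : V} {𝓤 𝓥 : Set (Set V)} {ζ : Config E} :
    ζ ∈ ((LocRows.srcU ends l h 𝓤).filter fun ζ => cluster ends (blue ζ) h ∈ 𝓥) ↔
      (h ∉ hull ends ζ l ∧ cluster ends (blue ζ) l ∈ 𝓤 ∧ cluster ends ζ l ∉ 𝓤) ∧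
        cluster ends (blue ζ) h ∈ 𝓥 := by
  simp [LocRows.srcU]

omit [LinearOrder R] [IsStrictOrderedRing R] in
/-- One term of `dom2Sum` is `1[ζ ∈ tgtU, C_B(h) ∈ 𝓥] − 1[ζ ∈ srcU, C_B(h) ∈ 𝓥]`. -/
lemma dom2Term_eq (l h : V) (𝓤 𝓥 : Set (Set V)) (ζ : Config E) :
    (if h ∉ hull ends ζ l then (1 : R) else 0) *
        ((if cluster ends ζ l ∈ 𝓤 then 1 else 0) - (if cluster ends (blue ζ) l ∈ 𝓤 then 1 else 0)) *
        (if cluster ends (blue ζ) h ∈ 𝓥 then 1 else 0) =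
      (if ζ ∈ ((LocRows.tgtU ends l h 𝓤).filter fun ζ => cluster ends (blue ζ) h ∈ 𝓥) then 1
        else 0) -
        (if ζ ∈ ((LocRows.srcU ends l h 𝓤).filter fun ζ => cluster ends (blue ζ) h ∈ 𝓥) then 1
          else 0) := by
  by_cases hh : h ∉ hull ends ζ l
  · by_cases hV : cluster ends (blue ζ) h ∈ 𝓥
    · by_cases hR : cluster ends ζ l ∈ 𝓤
      · by_cases hB : cluster ends (blue ζ) l ∈ 𝓤
        · have h1 : ζ ∉ ((LocRows.tgtU ends l h 𝓤).filter fun ζ => cluster ends (blue ζ) h ∈ 𝓥) :=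
            fun h => ((mem_tgtUIn ends).1 h).1.2.2 hB
          have h2 : ζ ∉ ((LocRows.srcU ends l h 𝓤).filter fun ζ => cluster ends (blue ζ) h ∈ 𝓥) :=
            fun h => ((mem_srcUIn ends).1 h).1.2.2 hR
          simp [hh, hV, hR, hB, h1, h2]
        · have h1 : ζ ∈ ((LocRows.tgtU ends l h 𝓤).filter fun ζ => cluster ends (blue ζ) h ∈ 𝓥) :=
            (mem_tgtUIn ends).2 ⟨⟨hh, hR, hB⟩, hV⟩
          have h2 : ζ ∉ ((LocRows.srcU ends l h 𝓤).filter fun ζ => cluster ends (blue ζ) h ∈ 𝓥) :=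
            fun h => ((mem_srcUIn ends).1 h).1.2.2 hR
          simp [hh, hV, hR, hB, h1, h2]
      · by_cases hB : cluster ends (blue ζ) l ∈ 𝓤
        · have h1 : ζ ∉ ((LocRows.tgtU ends l h 𝓤).filter fun ζ => cluster ends (blue ζ) h ∈ 𝓥) :=
            fun h => hR ((mem_tgtUIn ends).1 h).1.2.1
          have h2 : ζ ∈ ((LocRows.srcU ends l h 𝓤).filter fun ζ => cluster ends (blue ζ) h ∈ 𝓥) :=
            (mem_srcUIn ends).2 ⟨⟨hh, hB, hR⟩, hV⟩
          simp [hh, hV, hR, hB, h1, h2]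
        · have h1 : ζ ∉ ((LocRows.tgtU ends l h 𝓤).filter fun ζ => cluster ends (blue ζ) h ∈ 𝓥) :=
            fun h => hR ((mem_tgtUIn ends).1 h).1.2.1
          have h2 : ζ ∉ ((LocRows.srcU ends l h 𝓤).filter fun ζ => cluster ends (blue ζ) h ∈ 𝓥) :=
            fun h => hB ((mem_srcUIn ends).1 h).1.2.1
          simp [hh, hV, hR, hB, h1, h2]
    · have h1 : ζ ∉ ((LocRows.tgtU ends l h 𝓤).filter fun ζ => cluster ends (blue ζ) h ∈ 𝓥) :=
        fun h => hV ((mem_tgtUIn ends).1 h).2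
      have h2 : ζ ∉ ((LocRows.srcU ends l h 𝓤).filter fun ζ => cluster ends (blue ζ) h ∈ 𝓥) :=
        fun h => hV ((mem_srcUIn ends).1 h).2
      simp [hV, h1, h2]
  · have h1 : ζ ∉ ((LocRows.tgtU ends l h 𝓤).filter fun ζ => cluster ends (blue ζ) h ∈ 𝓥) :=
      fun h => hh ((mem_tgtUIn ends).1 h).1.1
    have h2 : ζ ∉ ((LocRows.srcU ends l h 𝓤).filter fun ζ => cluster ends (blue ζ) h ∈ 𝓥) :=
      fun h => hh ((mem_srcUIn ends).1 h).1.1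
    simp [hh, h1, h2]

omit [LinearOrder R] [IsStrictOrderedRing R] in
/-- **`dom2Sum = #(tgtU ∩ {C_B(h) ∈ 𝓥}) − #(srcU ∩ {C_B(h) ∈ 𝓥})`.** -/
theorem dom2Sum_eq_card_sub_card (l h : V) (𝓤 𝓥 : Set (Set V)) :
    dom2Sum ends R l h 𝓤 𝓥 =
      ((((LocRows.tgtU ends l h 𝓤).filter fun ζ => cluster ends (blue ζ) h ∈ 𝓥)).card : R) -
        ((((LocRows.srcU ends l h 𝓤).filter fun ζ => cluster ends (blue ζ) h ∈ 𝓥)).card : R) := by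
  unfold dom2Sum
  simp_rw [dom2Term_eq ends l h 𝓤 𝓥]
  rw [Finset.sum_sub_distrib, Finset.sum_boole, Finset.sum_boole,
    Finset.filter_mem_eq_inter, Finset.filter_mem_eq_inter, Finset.univ_inter, Finset.univ_inter]

omit [Fintype E] [DecidableEq E] in
/-- A `C_B(l)`-local recolouring of a configuration with `h ∉ H_l` can only ENLARGE the blue
cluster of `h`. -/
lemma cluster_blue_subset_of_localAtSet_blue {l h : V} {ζ ω : Config E}
    (hh : h ∉ hull ends ζ l)
    (hloc : LocRows.LocalAtSet ends (fun ζ => cluster ends (blue ζ) l) ζ ω) :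
    cluster ends (blue ζ) h ⊆ cluster ends (blue ω) h := by
  intro u hu
  rw [mem_cluster] at hu ⊢
  refine conn_of_eqOn_off_touches (ω := blue ζ) (l := l) (P := cluster ends (blue ζ) l)
    subset_rfl (fun hB => hh (Or.inr hB)) ?_ hu
  intro e he
  have : ω e = ζ e := by
    by_contra hne
    exact he (hloc e hne)
  simp [blue_apply, this]

/-- **The counting inequality**: under `(LOC-𝓤)`, `#(srcU ∩ {C_B(h) ∈ 𝓥}) ≤ #(tgtU ∩ {C_B(h) ∈ 𝓥})`
for every up-set `𝓥`. -/
theorem card_srcUIn_le_of_locU {l h : V} {𝓤 : Set (Set V)} (hl : LocRows.LocU ends l h 𝓤)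
    {𝓥 : Set (Set V)} (h𝓥 : IsUpperSet 𝓥) :
    (((LocRows.srcU ends l h 𝓤).filter fun ζ => cluster ends (blue ζ) h ∈ 𝓥)).card ≤
      (((LocRows.tgtU ends l h 𝓤).filter fun ζ => cluster ends (blue ζ) h ∈ 𝓥)).card := by
  obtain ⟨f, hf, hmem⟩ := hl
  let F : Config E → Config E := fun ζ =>
    if hζ : ζ ∈ LocRows.srcU ends l h 𝓤 then f ⟨ζ, hζ⟩ else ζ
  refine Finset.card_le_card_of_injOn F ?_ ?_
  · intro ζ hζ
    have hζ' := (mem_srcUIn ends).1 hζ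
    have hs : ζ ∈ LocRows.srcU ends l h 𝓤 := by
      simp [LocRows.srcU, hζ'.1.1, hζ'.1.2.1, hζ'.1.2.2]
    have hF : F ζ = f ⟨ζ, hs⟩ := by simp [F, hs]
    rw [hF]
    obtain ⟨ht, hloc⟩ := hmem ⟨ζ, hs⟩
    have ht' : h ∉ hull ends (f ⟨ζ, hs⟩) l ∧ cluster ends (f ⟨ζ, hs⟩) l ∈ 𝓤 ∧
        cluster ends (blue (f ⟨ζ, hs⟩)) l ∉ 𝓤 := by
      simpa [LocRows.tgtU] using ht
    refine (mem_tgtUIn ends).2 ⟨ht', h𝓥 ?_ hζ'.2⟩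
    exact cluster_blue_subset_of_localAtSet_blue ends hζ'.1.1 hloc
  · intro ζ₁ hζ₁ ζ₂ hζ₂ hF
    have h1 := (mem_srcUIn ends).1 (Finset.mem_coe.1 hζ₁)
    have h2 := (mem_srcUIn ends).1 (Finset.mem_coe.1 hζ₂)
    have hs1 : ζ₁ ∈ LocRows.srcU ends l h 𝓤 := by
      simp [LocRows.srcU, h1.1.1, h1.1.2.1, h1.1.2.2]
    have hs2 : ζ₂ ∈ LocRows.srcU ends l h 𝓤 := by
      simp [LocRows.srcU, h2.1.1, h2.1.2.1, h2.1.2.2]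
    have hF1 : F ζ₁ = f ⟨ζ₁, hs1⟩ := by simp [F, hs1]
    have hF2 : F ζ₂ = f ⟨ζ₂, hs2⟩ := by simp [F, hs2]
    rw [hF1, hF2] at hF
    exact congrArg Subtype.val (hf hF)

/-- **`(LOC-𝓤)` at `𝓤` gives row 2′DOM2 at `(𝓤, 𝓥)` on the free fibre, for every up-set `𝓥`.** -/
theorem dom2Sum_nonneg_of_locU {l h : V} {𝓤 : Set (Set V)} (hl : LocRows.LocU ends l h 𝓤)
    {𝓥 : Set (Set V)} (h𝓥 : IsUpperSet 𝓥) : 0 ≤ dom2Sum ends R l h 𝓤 𝓥 := by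
  rw [dom2Sum_eq_card_sub_card, sub_nonneg]
  exact_mod_cast card_srcUIn_le_of_locU ends hl h𝓥

omit [LinearOrder R] [IsStrictOrderedRing R] in
/-- At the principal up-set `{S ∣ o ∈ S}` the 2′DOM2 count is the free-fibre domination sum of
row 2′DOM. -/
lemma dom2Sum_principal_eq (z : Config E) (l o h : V) (𝓥 : Set (Set V)) :
    dom2Sum ends R l h {S | o ∈ S} 𝓥 = domSumG R ends Finset.univ z l o h 𝓥 := by
  unfold dom2Sum domSumG
  rw [domFunG_univ]
  refine Finset.sum_congr rfl fun ζ _ => ?_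
  unfold sideSign
  simp only [Set.mem_setOf_eq, mem_cluster]
  by_cases hR : o ∈ rside ends ζ l
  · have hB : o ∉ bside ends ζ l := fun hB => rside_disjoint_bside ζ l o hR hB
    have hCR : Conn ends ζ l o := hR.1
    have hCB : ¬ Conn ends (blue ζ) l o := hR.2
    simp [hR, hB, hCR, hCB]
  · by_cases hB : o ∈ bside ends ζ l
    · have hCB : Conn ends (blue ζ) l o := hB.1
      have hCR : ¬ Conn ends ζ l o := hB.2
      simp only [hR, hB, hCR, hCB, if_true, if_false]
      split_ifs <;> simp
    · -- `o` in the core or outside the hull: both indicators agree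
      have key : (Conn ends ζ l o ↔ Conn ends (blue ζ) l o) := by
        constructor
        · intro hc
          by_contra hb
          exact hR ⟨hc, hb⟩
        · intro hb
          by_contra hc
          exact hB ⟨hb, hc⟩
      by_cases hc : Conn ends ζ l o
      · have hb : Conn ends (blue ζ) l o := key.1 hc
        simp [hR, hB, hc, hb]
      · have hb : ¬ Conn ends (blue ζ) l o := fun hb => hc (key.2 hb)
        simp [hR, hB, hc, hb]

/-- **`(LOC-𝓤)` at the principal up-set `{S ∣ o ∈ S}` gives row 2′DOM on the free fibre** (the
BL-local replacement of `Loc0Dom.domSumG_univ_nonneg_of_loc0`). -/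
theorem domSumG_univ_nonneg_of_locU {l o h : V} (hl : LocRows.LocU ends l h {S | o ∈ S})
    (z : Config E) {𝓥 : Set (Set V)} (h𝓥 : IsUpperSet 𝓥) :
    0 ≤ domSumG R ends Finset.univ z l o h 𝓥 := by
  rw [← dom2Sum_principal_eq]
  exact dom2Sum_nonneg_of_locU ends hl h𝓥

end Hull

end Summit.Ventures.PercRepro2
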